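import Mathlib
import HarnessLib
import Literature.NumberTheory.Sieve.SelbergSymmetryFormula
import Literature.NumberTheory.LFunctions.RosserSchoenfeldMertensFirstConstantCorollaries

/-!
# Route `IntegerScrew` — the von Mangoldt coupling form on the flat vector: `≥ (log M − γ − o(1))·H_M`

PIVOT-LAW §13.2 LEMMA N (ii) / §13.7 PROP. N2, lower half, with its constant: on the flat vector
`c_m = m^{-1/2}` the coupling form `B_M(c) = ∑_{mn ≤ M} Λ(n) n^{-1/2} c_{mn} c_m` equals
`∑_{m ≤ M} (1/m) ∑_{n ≤ M/m} Λ(n)/n`, and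

* `vonMangoldtCoupling_flat_ge_eventually` : for every `δ > 0` and all sufficiently large `M`,
  `(log M − γ − δ) · ∑_{m ≤ M} 1/m ≤ 2 B_M(m^{-1/2})`,

so `ν_max(N_M) ≥ log M − γ − o(1)`; with `IntegerScrewVonMangoldtCouplingSharp.lean`
(`2 |B_M(c)| ≤ (log M − γ + δ) ∑ c_k²` eventually) the top eigenvalue of the von Mangoldt coupling matrix is
`log M − γ + o(1)` — the NYQUIST RATIO `2π e^{−γ}` of the Suzuki screw ladder (PIVOT-LAW §13.7 (f)) is a
kernel fact on both sides.  Inputs: the tree's `Σ_{n ≤ x} Λ(n)/n − log x → −γ`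
(`Literature.NumberTheory.LFunctions.tendsto_sum_vonMangoldt_div_sub_log`, Rosser–Schoenfeld 1962), the
explicit `|Σ_{n ≤ x} Λ(n)/n − log x| ≤ 6` (`…SelbergSymmetry.abs_sum_vonMangoldt_div_sub_log_le`), Mathlib's
`Real.tendsto_harmonic_sub_log` (`H_M − log M → γ`), and `∑_{m ≤ M} log m/m ≤ (log² M + 1)/2` (telescoping,
as in `IntegerScrewVonMangoldtCoupling.lean`, restated privately because that module's olean is not available to
this file).  RH-free; nothing here bears on the truth of RH.  References: M. Suzuki, J. Lond. Math. Soc. (2) 108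
(2023) 1448–1487 [Suzuki2023]; J. B. Rosser, L. Schoenfeld, Illinois J. Math. 6 (1962) 64–94
[RosserSchoenfeld1962].
-/

noncomputable section

-- D-0017: `Summit.<S>.<S>.…` is the designed namespace of a single-problem summit.
set_option linter.dupNamespace false

namespace Summit.RiemannHypothesis.RiemannHypothesis.Theorems.IntegerScrew

open Finset ArithmeticFunction Filter

/-- The flat term: `Λ(n) n^{-1/2} · (mn)^{-1/2} · m^{-1/2} = Λ(n)/n · 1/m` for `m, n ≥ 1`
(restated privately; see `IntegerScrewVonMangoldtCoupling.lean`). -/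
private theorem flat_term' {m n : ℕ} (hm : 1 ≤ m) (hn : 1 ≤ n) :
    Λ n / Real.sqrt n * ((Real.sqrt ((m * n : ℕ) : ℝ))⁻¹ * (Real.sqrt m)⁻¹) = Λ n / n * (1 / m) := by
  have hm0 : (0 : ℝ) < m := by exact_mod_cast hm
  have hn0 : (0 : ℝ) < n := by exact_mod_cast hn
  rw [Nat.cast_mul, Real.sqrt_mul hm0.le]
  have hm2 : Real.sqrt m * Real.sqrt m = m := Real.mul_self_sqrt hm0.le
  have hn2 : Real.sqrt n * Real.sqrt n = n := Real.mul_self_sqrt hn0.le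
  have hsm : 0 < Real.sqrt m := Real.sqrt_pos.mpr hm0
  have hsn : 0 < Real.sqrt n := Real.sqrt_pos.mpr hn0
  calc Λ n / Real.sqrt n * ((Real.sqrt m * Real.sqrt n)⁻¹ * (Real.sqrt m)⁻¹)
      = Λ n * ((Real.sqrt n * Real.sqrt n)⁻¹ * (Real.sqrt m * Real.sqrt m)⁻¹) := by
        field_simp
    _ = Λ n * (((n : ℝ))⁻¹ * ((m : ℝ))⁻¹) := by rw [hn2, hm2]
    _ = Λ n / n * (1 / m) := by ring

/-- `∑_{n ≤ M/m} Λ(n)/n ≥ log M − log m − 6` for `1 ≤ m ≤ M` (the tree's explicit Mertens bound at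
`x = M/m`; restated privately). -/
private theorem log_sub_six_le_sum' {M m : ℕ} (hm : m ∈ Icc 1 M) :
    Real.log M - Real.log m - 6 ≤ ∑ n ∈ Icc 1 (M / m), Λ n / n := by
  obtain ⟨hm1, hmM⟩ := mem_Icc.1 hm
  have hm0 : (0 : ℝ) < m := by exact_mod_cast hm1
  have hM0 : (0 : ℝ) < M := by exact_mod_cast (show 0 < M by omega)
  have hx : (1 : ℝ) ≤ (M : ℝ) / m := by
    rw [le_div_iff₀ hm0, one_mul]; exact_mod_cast hmM
  have h := Literature.NumberTheory.Sieve.SelbergSymmetry.abs_sum_vonMangoldt_div_sub_log_le hx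
  rw [Nat.floor_div_eq_div] at h
  have hI : Icc 1 (M / m) = Ioc 0 (M / m) := by ext k; simp only [mem_Icc, mem_Ioc]; omega
  rw [hI, ← Real.log_div hM0.ne' hm0.ne']
  have := (abs_le.1 h).1
  linarith

/-- One telescoping step for `∑ log m / m`: for `m ≥ 2`,
`log m / m ≤ ½ (log² m − log² (m−1)) + 1/(2 m (m−1))`, from `1 − 1/x ≤ log x ≤ x − 1`
(same proof as `log_div_le_telescope` in `IntegerScrewVonMangoldtCoupling.lean`; restated privately). -/
private theorem log_div_le_telescope' {m : ℕ} (hm : 2 ≤ m) :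
    Real.log m / m ≤ (Real.log m ^ 2 - Real.log ((m : ℝ) - 1) ^ 2) / 2 + 1 / (2 * m * ((m : ℝ) - 1)) := by
  have hm0 : (0 : ℝ) < m := by exact_mod_cast (show 0 < m by omega)
  have hm1 : (0 : ℝ) < (m : ℝ) - 1 := by
    have : (2 : ℝ) ≤ m := by exact_mod_cast hm
    linarith
  set a := Real.log m with ha
  set b := Real.log ((m : ℝ) - 1) with hb
  have hab : a - b = Real.log ((m : ℝ) / ((m : ℝ) - 1)) := by
    rw [ha, hb, Real.log_div hm0.ne' hm1.ne']
  have hq : (0 : ℝ) < (m : ℝ) / ((m : ℝ) - 1) := by positivity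
  have hlow : 1 / (m : ℝ) ≤ a - b := by
    rw [hab]
    have h := Real.one_sub_inv_le_log_of_pos hq
    have heq : 1 - ((m : ℝ) / ((m : ℝ) - 1))⁻¹ = 1 / (m : ℝ) := by field_simp; ring
    linarith
  have hup : a - b ≤ 1 / ((m : ℝ) - 1) := by
    rw [hab]
    have h := Real.log_le_sub_one_of_pos hq
    have heq : (m : ℝ) / ((m : ℝ) - 1) - 1 = 1 / ((m : ℝ) - 1) := by field_simp; ring
    linarith
  have hm2 : (2 : ℝ) ≤ m := by exact_mod_cast hm
  have hb0 : 0 ≤ b := by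
    rw [hb]; exact Real.log_nonneg (by linarith)
  have ha0 : 0 ≤ a := by rw [ha]; exact Real.log_nonneg (by linarith)
  have h1 : (a ^ 2 - b ^ 2) / 2 = (a - b) * (a + b) / 2 := by ring
  have h2 : 1 / (m : ℝ) * (a + b) ≤ (a - b) * (a + b) :=
    mul_le_mul_of_nonneg_right hlow (by linarith)
  have h3 : 1 / (m : ℝ) * (2 * a - 1 / ((m : ℝ) - 1)) ≤ 1 / (m : ℝ) * (a + b) :=
    mul_le_mul_of_nonneg_left (by linarith) (by positivity)
  have h4 : 1 / (m : ℝ) * (2 * a - 1 / ((m : ℝ) - 1)) / 2 + 1 / (2 * m * ((m : ℝ) - 1)) = a / m := by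
    have hmne : (m : ℝ) ≠ 0 := hm0.ne'
    have hm1ne : (m : ℝ) - 1 ≠ 0 := hm1.ne'
    field_simp
    ring
  rw [h1]
  have h5 : Real.log m / m = a / m := by rw [ha]
  rw [h5]
  linarith [h2, h3, h4]

/-- `∑_{m ≤ M} log m / m ≤ ½ log² M + ½ − 1/(2M)` for `M ≥ 1` (restated privately). -/
private theorem sum_log_div_le' (M : ℕ) (hM : 1 ≤ M) :
    ∑ m ∈ Icc 1 M, Real.log m / m ≤ Real.log M ^ 2 / 2 + 1 / 2 - 1 / (2 * (M : ℝ)) := by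
  induction M, hM using Nat.le_induction with
  | base => simp
  | succ M hM ih =>
    rw [sum_Icc_succ_top (by omega)]
    have hstep := log_div_le_telescope' (m := M + 1) (by omega)
    have hcast : ((M + 1 : ℕ) : ℝ) - 1 = (M : ℝ) := by push_cast; ring
    rw [hcast] at hstep
    have hM0 : (0 : ℝ) < M := by exact_mod_cast hM
    have hfrac : 1 / (2 * ((M + 1 : ℕ) : ℝ) * (M : ℝ)) = 1 / (2 * (M : ℝ)) - 1 / (2 * ((M + 1 : ℕ) : ℝ)) := by
      push_cast; field_simp; ring
    rw [hfrac] at hstep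
    linarith

/-- The harmonic sum as a real sum over `Icc 1 M`. -/
private theorem harmonic_cast_eq (M : ℕ) :
    ((harmonic M : ℚ) : ℝ) = ∑ m ∈ Icc 1 M, (1 : ℝ) / m := by
  rw [harmonic_eq_sum_Icc]
  push_cast
  refine sum_congr rfl fun m _ => ?_
  rw [one_div]

/-- **LEMMA N (ii) / PROP. N2, lower half with its constant** (PIVOT-LAW §13.2, §13.7 (f)): for every
`δ > 0` and all sufficiently large `M`, on the flat vector `c_m = m^{-1/2}` the coupling form is at least
`(log M − γ − δ)·∑_{m ≤ M} 1/m`; hence `ν_max(N_M) ≥ log M − γ − o(1)`.  RH-free. -/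
theorem vonMangoldtCoupling_flat_ge_eventually {δ : ℝ} (hδ : 0 < δ) :
    ∀ᶠ M : ℕ in atTop,
      (Real.log M - Real.eulerMascheroniConstant - δ) * ∑ m ∈ Icc 1 M, (1 : ℝ) / m ≤
        2 * ∑ m ∈ Icc 1 M, ∑ n ∈ Icc 1 (M / m),
          Λ n / Real.sqrt n * ((Real.sqrt ((m * n : ℕ) : ℝ))⁻¹ * (Real.sqrt m)⁻¹) := by
  set γ : ℝ := Real.eulerMascheroniConstant with hγ
  have hγ0 : 0 < γ := by rw [hγ]; linarith [Real.one_half_lt_eulerMascheroniConstant]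
  -- Mertens with its constant, lower side: ∑_{n ≤ x} Λ(n)/n − log x > −γ − δ/3 for x ≥ x₀
  have hlim := Literature.NumberTheory.LFunctions.tendsto_sum_vonMangoldt_div_sub_log
  have hev : ∀ᶠ x : ℝ in atTop,
      -γ - δ / 3 < ∑ n ∈ Finset.Ioc 0 ⌊x⌋₊, Λ n / n - Real.log x :=
    (tendsto_order.1 hlim).1 _ (by rw [hγ]; linarith)
  obtain ⟨x₁, hx₁⟩ := eventually_atTop.1 hev
  set x₀ : ℝ := max x₁ 1 with hx₀
  have hx₀1 : 1 ≤ x₀ := le_max_right _ _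
  have hx₀0 : 0 < x₀ := by linarith
  -- harmonic numbers: |H_M − log M − γ| < δ/18 eventually
  have hharm := Real.tendsto_harmonic_sub_log
  have hH1 : ∀ᶠ M : ℕ in atTop, ((harmonic M : ℚ) : ℝ) - Real.log M < γ + δ / 18 :=
    (tendsto_order.1 hharm).2 _ (by rw [hγ]; linarith)
  have hH2 : ∀ᶠ M : ℕ in atTop, γ - δ / 18 < ((harmonic M : ℚ) : ℝ) - Real.log M :=
    (tendsto_order.1 hharm).1 _ (by rw [hγ]; linarith)
  have hlog : Tendsto (fun M : ℕ => Real.log M) atTop atTop :=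
    Real.tendsto_log_atTop.comp tendsto_natCast_atTop_atTop
  filter_upwards [eventually_ge_atTop 3, hH1, hH2,
    hlog.eventually_ge_atTop ((12 / δ) * (6 * x₀ + 2 + γ ^ 2 + γ * δ + δ ^ 2)),
    hlog.eventually_ge_atTop (γ + δ)]
    with M hM3 hHM1 hHM2 hL hLγ
  have hM1 : 1 ≤ M := by omega
  have hM0 : (0 : ℝ) < M := by exact_mod_cast (show 0 < M by omega)
  have hLpos : 0 < Real.log M := by
    have : (3 : ℝ) ≤ M := by exact_mod_cast hM3
    exact Real.log_pos (by linarith)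
  set L : ℝ := Real.log M with hLdef
  set H : ℝ := ∑ m ∈ Icc 1 M, (1 : ℝ) / m with hHdef
  have hHcast : ((harmonic M : ℚ) : ℝ) = H := harmonic_cast_eq M
  rw [hHcast] at hHM1 hHM2
  -- rewrite the flat form
  have hform : ∑ m ∈ Icc 1 M, ∑ n ∈ Icc 1 (M / m),
        Λ n / Real.sqrt n * ((Real.sqrt ((m * n : ℕ) : ℝ))⁻¹ * (Real.sqrt m)⁻¹) =
      ∑ m ∈ Icc 1 M, (1 / (m : ℝ)) * ∑ n ∈ Icc 1 (M / m), Λ n / n := by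
    refine sum_congr rfl fun m hm => ?_
    rw [mul_sum]
    refine sum_congr rfl fun n hn => ?_
    rw [flat_term' (mem_Icc.1 hm).1 (mem_Icc.1 hn).1, mul_comm]
  rw [hform]
  -- termwise lower bound: (1/m) S₁(M/m) ≥ (1/m)(L − log m − γ − δ/3) − 6 x₀/M
  have hterm : ∀ m ∈ Icc 1 M, (1 / (m : ℝ)) * (L - Real.log m - γ - δ / 3) - 6 * x₀ / M ≤
      (1 / (m : ℝ)) * ∑ n ∈ Icc 1 (M / m), Λ n / n := by
    intro m hm
    obtain ⟨hm1, hmM⟩ := mem_Icc.1 hm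
    have hm0 : (0 : ℝ) < m := by exact_mod_cast hm1
    have hpos : 0 ≤ 6 * x₀ / (M : ℝ) := by positivity
    by_cases hcase : x₀ ≤ (M : ℝ) / m
    · -- Mertens with its constant at x = M/m
      have hx : x₁ ≤ (M : ℝ) / m := (le_max_left _ _).trans hcase
      have h := hx₁ _ hx
      rw [Nat.floor_div_eq_div, Real.log_div hM0.ne' hm0.ne'] at h
      have hI : Icc 1 (M / m) = Ioc 0 (M / m) := by ext k; simp only [mem_Icc, mem_Ioc]; omega
      rw [hI]
      have h' : L - Real.log m - γ - δ / 3 ≤ ∑ n ∈ Ioc 0 (M / m), Λ n / n := by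
        rw [hLdef]; linarith
      have := mul_le_mul_of_nonneg_left h' (show 0 ≤ 1 / (m : ℝ) by positivity)
      linarith
    · -- small M/m: crude Mertens, and 1/m < x₀/M
      have hcase' : (M : ℝ) / m < x₀ := not_le.mp hcase
      have hinv : 1 / (m : ℝ) ≤ x₀ / M := by
        rw [div_le_div_iff₀ hm0 hM0, one_mul]
        rw [div_lt_iff₀ hm0] at hcase'
        linarith
      have h6 := log_sub_six_le_sum' hm
      have h6' : (1 / (m : ℝ)) * (L - Real.log m - 6) ≤ (1 / (m : ℝ)) * ∑ n ∈ Icc 1 (M / m), Λ n / n :=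
        mul_le_mul_of_nonneg_left (by rw [hLdef]; exact h6) (by positivity)
      have hsplit : (1 / (m : ℝ)) * (L - Real.log m - γ - δ / 3) - 6 * x₀ / M ≤
          (1 / (m : ℝ)) * (L - Real.log m - 6) := by
        have h1m : 0 ≤ 1 / (m : ℝ) := by positivity
        have key : (1 / (m : ℝ)) * (L - Real.log m - 6) =
            (1 / (m : ℝ)) * (L - Real.log m - γ - δ / 3) + (1 / (m : ℝ)) * (γ + δ / 3 - 6) := by ring
        have hA : (1 / (m : ℝ)) * (-6) ≤ (1 / (m : ℝ)) * (γ + δ / 3 - 6) :=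
          mul_le_mul_of_nonneg_left (by linarith) h1m
        have hB : -(6 * x₀ / (M : ℝ)) ≤ (1 / (m : ℝ)) * (-6) := by
          have := mul_le_mul_of_nonneg_left hinv (show (0 : ℝ) ≤ 6 by norm_num)
          have h6 : (6 : ℝ) * (x₀ / M) = 6 * x₀ / M := by ring
          linarith
        rw [key]
        linarith
      linarith
  have hsum := sum_le_sum hterm
  -- left side of hsum in closed form
  have hleft : ∑ m ∈ Icc 1 M, ((1 / (m : ℝ)) * (L - Real.log m - γ - δ / 3) - 6 * x₀ / M) =
      (L - γ - δ / 3) * H - ∑ m ∈ Icc 1 M, Real.log m / m - 6 * x₀ := by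
    rw [sum_sub_distrib, sum_const, Nat.card_Icc, Nat.add_sub_cancel, nsmul_eq_mul]
    have hc : (M : ℝ) * (6 * x₀ / M) = 6 * x₀ := by field_simp
    rw [hc, hHdef, mul_sum, ← sum_sub_distrib]
    congr 1
    refine sum_congr rfl fun m _ => ?_
    ring
  rw [hleft] at hsum
  have hS := sum_log_div_le' M hM1
  -- assemble: (L − γ − δ) H ≤ 2[(L − γ − δ/3)H − ∑ log m/m − 6x₀]
  have hHlo : L + γ - δ / 18 ≤ H := by linarith
  have hHhi : H ≤ L + γ + δ / 18 := by linarith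
  have hH0 : 0 ≤ H := by linarith
  have hmain : (L - γ - δ) * H ≤
      2 * ((L - γ - δ / 3) * H - ∑ m ∈ Icc 1 M, Real.log m / m - 6 * x₀) := by
    have hS' : ∑ m ∈ Icc 1 M, Real.log m / m ≤ L ^ 2 / 2 + 1 / 2 := by
      have : 0 ≤ 1 / (2 * (M : ℝ)) := by positivity
      rw [hLdef]; linarith
    -- reduce to an inequality in L, H
    have hpos1 : 0 ≤ L - γ + δ / 3 := by linarith
    have hstep1 : (L - γ + δ / 3) * (L + γ - δ / 18) ≤ (L - γ + δ / 3) * H :=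
      mul_le_mul_of_nonneg_left hHlo hpos1
    have hexp : (L - γ + δ / 3) * (L + γ - δ / 18) =
        L ^ 2 + 5 * δ / 18 * L - γ ^ 2 + 7 / 18 * (γ * δ) - δ ^ 2 / 54 := by ring
    have hδL : 10 / 3 * (6 * x₀ + 2 + γ ^ 2 + γ * δ + δ ^ 2) ≤ 5 * δ / 18 * L := by
      have h := mul_le_mul_of_nonneg_left hL hδ.le
      have heq : δ * (12 / δ * (6 * x₀ + 2 + γ ^ 2 + γ * δ + δ ^ 2)) =
          12 * (6 * x₀ + 2 + γ ^ 2 + γ * δ + δ ^ 2) := by field_simp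
      rw [heq] at h
      linarith
    have hR : 2 * ((L - γ - δ / 3) * H - ∑ m ∈ Icc 1 M, Real.log m / m - 6 * x₀) - (L - γ - δ) * H =
        (L - γ + δ / 3) * H - 2 * ∑ m ∈ Icc 1 M, Real.log m / m - 12 * x₀ := by ring
    have hγδ : 0 ≤ γ * δ := mul_nonneg hγ0.le hδ.le
    nlinarith [hstep1, hexp, hδL, hS', hR, hγδ, sq_nonneg γ, sq_nonneg δ, hx₀0.le]
  calc (L - γ - δ) * H ≤ 2 * ((L - γ - δ / 3) * H - ∑ m ∈ Icc 1 M, Real.log m / m - 6 * x₀) := hmain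
    _ ≤ 2 * ∑ m ∈ Icc 1 M, (1 / (m : ℝ)) * ∑ n ∈ Icc 1 (M / m), Λ n / n := by linarith

end Summit.RiemannHypothesis.RiemannHypothesis.Theorems.IntegerScrew

end
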